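import Summits.QuantumFields.YangMills.Theorems.LuscherReductionTwistedTraceScalingBOStiffSepConditions
import Summits.QuantumFields.YangMills.Theorems.LuscherReductionTwistedTraceScalingBOCentralSchedule
import Summits.QuantumFields.YangMills.Theorems.LuscherReductionTwistedTraceScalingBOCentralEventually
import Summits.QuantumFields.YangMills.Theorems.LuscherReductionTwistedTraceScalingRecordInequalities
import Summits.QuantumFields.YangMills.Theorems.LuscherReductionTwistedTraceScalingBOStiffSepEventually
import HarnessLib

/-!
# The stiff-separation schedule AT THE RATE TWIN'S EXPONENT `s = 1/6` with a general cap constant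

Support file for the crux `NearFlatRatioLaw` (line `ratepack_v2`, stub `stub_hODpot_A`; successor step (E2) of memo v8 (g19),
`Cruxes/NearFlatRatioLaw/Lines/ratepack-v8-core-g19.md` §3).  Lane A's `…BOStiffSepEventually.eventually_stiffSep_conditions` needs `1/6 < s < 1/2` because its third atom is
`ε₂ = 14³β^{-(3s−1/2)}`.  At `s = 1/6` the logarithm in `r_F = β^{-1/2}ℓ` suffices: with the atoms `ε₁ := K_c·β^{-1/6}` (so that `a_U = K_cMβ^{-1/6} ≤ 43Mε₁`, `δ = D·recordDelta1 ≤ ε₁`,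
`δ' = (12K_c+1)β^{-1/6}/|Λ| ≤ 37ε₁`) and `ε₂ := K_c³/btLog β → 0`, one has `ε₁³ = K_c³β^{-1/2} = ε₂·r_F` and `r_F ≤ ε₁` eventually, and the three polynomial conditions of
`…BOStiffSepConditions.stiffSep_conditions` (continuous in `(r_F, ε₁, ε₂)`, vanishing at `0`) hold eventually.
★★ `eventually_stiffSep_conditions_K` — the eleven conditions of `…BOStiffSepRecord.avgKernel_le_of_stiffSep_record` with `δ = D·recordDelta1 L (1/6) β`,
`δ' = (12K_c+1)β^{-1/6}/|Λ|`, `a_U = K_cMβ^{-1/6}`, eventually in `β` (`D ≥ 0`, `K_c ≥ 1`, `14D/|Λ| ≤ K_c`).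
-/

set_option autoImplicit false

noncomputable section

open Filter Topology Real
open scoped BigOperators
open Literature.MathematicalPhysics.QuantumFieldTheory
open Literature.MathematicalPhysics.QuantumLattice

namespace Summit.QuantumFields.YangMills.Theorems.FemtoTransferGap.TwoLattice.ConstTube

open Summit.QuantumFields.YangMills.Theorems.FemtoTransferGap
open Summit.QuantumFields.YangMills.Theorems.FemtoTransferGap.TwoLattice

variable {L : ℕ} [NeZero L]

set_option maxHeartbeats 1600000 in
-- long eventual bookkeeping with the explicit record expressions.
/-- ★★ **THE STIFF-SEPARATION SCHEDULE AT `s = 1/6`** (see the module docstring). [folklore] -/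
theorem eventually_stiffSep_conditions_K {D Kc : ℝ} (hD0 : 0 ≤ D) (hKc : 1 ≤ Kc) (hDK : 14 * D / Fintype.card (Site 3 L) ≤ Kc) {M : ℝ} (hM : 0 ≤ M) {C : ℝ} (hC : 0 < C) :
    ∀ᶠ β : ℝ in atTop,
      0 ≤ (min (1 / 40) (powScale (1 / 2) β * btLog β)) ∧ (min (1 / 40) (powScale (1 / 2) β * btLog β)) / 24 ≤ 1 / 20 ∧ 0 ≤ (powScale 1 β * btLog β) ∧ 0 ≤ ((D * recordDelta1 L (1 / 6) β)) ∧ ((D * recordDelta1 L (1 / 6) β)) ≤ 1 ∧ 0 ≤ ((12 * Kc + 1) / Fintype.card (Site 3 L) * powScale (1 / 6) β) ∧ 0 ≤ (M * (Kc * powScale (1 / 6) β)) ∧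
      12 * Real.sqrt (3 * Fintype.card (Edge 3 L)) * ((D * recordDelta1 L (1 / 6) β)) * C ≤ 1 / 2 ∧
      3 * L * (((min (1 / 40) (powScale (1 / 2) β * btLog β)) / 1000) + (M * (Kc * powScale (1 / 6) β)) + (Real.sqrt 2 * ((min (1 / 40) (powScale (1 / 2) β * btLog β)) / 24) + ((D * recordDelta1 L (1 / 6) β)))) ≤ 1 / 40 ∧
      2 * (2 * C * (2 * (powScale 1 β * btLog β) + (Real.sqrt 6 * ((min (1 / 40) (powScale (1 / 2) β * btLog β)) / 1000) + Real.sqrt (6 * Fintype.card (Edge 3 L)) * ((40 * (4 * (3 * L * (((min (1 / 40) (powScale (1 / 2) β * btLog β)) / 1000) + (M * (Kc * powScale (1 / 6) β)) + (Real.sqrt 2 * ((min (1 / 40) (powScale (1 / 2) β * btLog β)) / 24) + ((D * recordDelta1 L (1 / 6) β))))) ^ 2 + 2 * (3 * L * (((min (1 / 40) (powScale (1 / 2) β * btLog β)) / 1000) + (M * (Kc * powScale (1 / 6) β)) + (Real.sqrt 2 * ((min (1 / 40) (powScale (1 / 2) β * btLog β)) / 24) + ((D * recordDelta1 L (1 /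 6) β))))) * ((min (1 / 40) (powScale (1 / 2) β * btLog β)) / 24)) + 12 * ((D * recordDelta1 L (1 / 6) β)) * (3 * L * (((min (1 / 40) (powScale (1 / 2) β * btLog β)) / 1000) + (M * (Kc * powScale (1 / 6) β)) + (Real.sqrt 2 * ((min (1 / 40) (powScale (1 / 2) β * btLog β)) / 24) + ((D * recordDelta1 L (1 / 6) β)))))) + 4 * (6 * (3 * L * (((min (1 / 40) (powScale (1 / 2) β * btLog β)) / 1000) + (M * (Kc * powScale (1 / 6) β)) + (Real.sqrt 2 * ((min (1 / 40) (powScale (1 / 2) β * btLog β)) / 24) + ((D * recordDelta1 L (1 / 6) β))))) + 2 * ((min (1 / 40) (powScale (1 / 2) β * btLog β)) / 24)) * (((D * recordDelta1 L (1 / 6) β)) + ((12 * Kc + 1) / Fintype.card (Site 3 L) * powScale (1 / 6) β)))))) ≤ 1 / 40 ∧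
      (powScale 1 β * btLog β) ^ 2 + (((min (1 / 40) (powScale (1 / 2) β * btLog β)) / 24) + 4 * (powScale 1 β * btLog β) + 4 * (Real.sqrt 6 * ((min (1 / 40) (powScale (1 / 2) β * btLog β)) / 1000) + Real.sqrt (6 * Fintype.card (Edge 3 L)) *
      ((40 * (4 * (2 * (2 * C * (2 * (powScale 1 β * btLog β) + (Real.sqrt 6 * ((min (1 / 40) (powScale (1 / 2) β * btLog β)) / 1000) + Real.sqrt (6 * Fintype.card (Edge 3 L)) * ((40 * (4 * (3 * L * (((min (1 / 40) (powScale (1 / 2) β * btLog β)) / 1000) + (M * (Kc * powScale (1 / 6) β)) + (Real.sqrt 2 * ((min (1 / 40) (powScale (1 / 2) β * btLog β)) / 24) + ((D * recordDelta1 L (1 / 6) β))))) ^ 2 + 2 * (3 * L * (((min (1 / 40) (powScale (1 / 2) β * btLog β)) / 1000) + (M * (Kc * powScale (1 / 6) β)) + (Real.sqrt 2 * ((min (1 / 40) (powScale (1 / 2) β * btLog β)) / 24) + ((D * recordDelta1 L (1 / 6) β))))) * ((min (1 / 40) (powScale (1 / 2) β * btLog β)) / 24)) + 12 * ((D * recordDelta1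 L (1 / 6) β)) * (3 * L * (((min (1 / 40) (powScale (1 / 2) β * btLog β)) / 1000) + (M * (Kc * powScale (1 / 6) β)) + (Real.sqrt 2 * ((min (1 / 40) (powScale (1 / 2) β * btLog β)) / 24) + ((D * recordDelta1 L (1 / 6) β)))))) + 4 * (6 * (3 * L * (((min (1 / 40) (powScale (1 / 2) β * btLog β)) / 1000) + (M * (Kc * powScale (1 / 6) β)) + (Real.sqrt 2 * ((min (1 / 40) (powScale (1 / 2) β * btLog β)) / 24) + ((D * recordDelta1 L (1 / 6) β))))) + 2 * ((min (1 / 40) (powScale (1 / 2) β * btLog β)) / 24)) * (((D * recordDelta1 L (1 / 6) β)) + ((12 * Kc + 1) / Fintype.card (Site 3 L) * powScale (1 / 6) β))))))) ^ 2 +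
          2 * (2 * (2 * C * (2 * (powScale 1 β * btLog β) + (Real.sqrt 6 * ((min (1 / 40) (powScale (1 / 2) β * btLog β)) / 1000) + Real.sqrt (6 * Fintype.card (Edge 3 L)) * ((40 * (4 * (3 * L * (((min (1 / 40) (powScale (1 / 2) β * btLog β)) / 1000) + (M * (Kc * powScale (1 / 6) β)) + (Real.sqrt 2 * ((min (1 / 40) (powScale (1 / 2) β * btLog β)) / 24) + ((D * recordDelta1 L (1 / 6) β))))) ^ 2 + 2 * (3 * L * (((min (1 / 40) (powScale (1 / 2) β * btLog β)) / 1000) + (M * (Kc * powScale (1 / 6) β)) + (Real.sqrt 2 * ((min (1 / 40) (powScale (1 / 2) β * btLog β)) / 24) + ((D * recordDelta1 L (1 / 6) β))))) * ((min (1 / 40) (powScale (1 / 2) β * btLog β)) / 24)) + 12 * ((D * recordDelta1 L (1 / 6) β)) * (3 * L * (((min (1 / 40) (powScale (1 / 2) β * btLog β)) / 1000) + (M * (Kc * powScale (1 / 6) β)) + (Real.sqrt 2 * ((min (1 / 40) (powScale (1 / 2) β * btLog β)) / 24) + ((D * recordDelta1 L (1 / 6) β)))))) + 4 * (6 * (3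 * L * (((min (1 / 40) (powScale (1 / 2) β * btLog β)) / 1000) + (M * (Kc * powScale (1 / 6) β)) + (Real.sqrt 2 * ((min (1 / 40) (powScale (1 / 2) β * btLog β)) / 24) + ((D * recordDelta1 L (1 / 6) β))))) + 2 * ((min (1 / 40) (powScale (1 / 2) β * btLog β)) / 24)) * (((D * recordDelta1 L (1 / 6) β)) + ((12 * Kc + 1) / Fintype.card (Site 3 L) * powScale (1 / 6) β))))))) * ((min (1 / 40) (powScale (1 / 2) β * btLog β)) / 24)) +
        12 * ((D * recordDelta1 L (1 / 6) β)) * (2 * C * (2 * (powScale 1 β * btLog β) + (Real.sqrt 6 * ((min (1 / 40) (powScale (1 / 2) β * btLog β)) / 1000) + Real.sqrt (6 * Fintype.card (Edge 3 L)) * ((40 * (4 * (3 * L * (((min (1 / 40) (powScale (1 / 2) β * btLog β)) / 1000) + (M * (Kc * powScale (1 / 6) β)) + (Real.sqrt 2 * ((min (1 / 40) (powScale (1 / 2) β * btLog β)) / 24) + ((D * recordDelta1 L (1 / 6) β))))) ^ 2 + 2 * (3 * L * (((min (1 / 40) (powScale (1 / 2) β * btLog β)) / 1000) + (M * (Kc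 * powScale (1 / 6) β)) + (Real.sqrt 2 * ((min (1 / 40) (powScale (1 / 2) β * btLog β)) / 24) + ((D * recordDelta1 L (1 / 6) β))))) * ((min (1 / 40) (powScale (1 / 2) β * btLog β)) / 24)) + 12 * ((D * recordDelta1 L (1 / 6) β)) * (3 * L * (((min (1 / 40) (powScale (1 / 2) β * btLog β)) / 1000) + (M * (Kc * powScale (1 / 6) β)) + (Real.sqrt 2 * ((min (1 / 40) (powScale (1 / 2) β * btLog β)) / 24) + ((D * recordDelta1 L (1 / 6) β)))))) + 4 * (6 * (3 * L * (((min (1 / 40) (powScale (1 / 2) β * btLog β)) / 1000) + (M * (Kc * powScale (1 / 6) β)) + (Real.sqrt 2 * ((min (1 / 40) (powScale (1 / 2) β * btLog β)) / 24) + ((D * recordDelta1 L (1 / 6) β))))) + 2 * ((min (1 / 40) (powScale (1 / 2) β * btLog β)) / 24)) * (((D * recordDelta1 L (1 / 6) β)) + ((12 * Kc + 1) / Fintype.card (Site 3 L) * powScale (1 / 6) β))))))) +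
        4 * (6 * (2 * (2 * C * (2 * (powScale 1 β * btLog β) + (Real.sqrt 6 * ((min (1 / 40) (powScale (1 / 2) β * btLog β)) / 1000) + Real.sqrt (6 * Fintype.card (Edge 3 L)) * ((40 * (4 * (3 * L * (((min (1 / 40) (powScale (1 / 2) β * btLog β)) / 1000) + (M * (Kc * powScale (1 / 6) β)) + (Real.sqrt 2 * ((min (1 / 40) (powScale (1 / 2) β * btLog β)) / 24) + ((D * recordDelta1 L (1 / 6) β))))) ^ 2 + 2 * (3 * L * (((min (1 / 40) (powScale (1 / 2) β * btLog β)) / 1000) + (M * (Kc * powScale (1 / 6) β)) + (Real.sqrt 2 * ((min (1 / 40) (powScale (1 / 2) β * btLog β)) / 24) + ((D * recordDelta1 L (1 / 6) β))))) * ((min (1 / 40) (powScale (1 / 2) β * btLog β)) / 24)) + 12 * ((D * recordDelta1 L (1 / 6) β)) * (3 * L * (((min (1 / 40) (powScale (1 / 2) β * btLog β)) / 1000) + (M * (Kc * powScale (1 / 6) β)) + (Real.sqrt 2 * ((min (1 / 40) (powScale (1 / 2) β * btLog β)) / 24) + ((D * recordDelta1 L (1 / 6) β)))))) + 4 * (6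 * (3 * L * (((min (1 / 40) (powScale (1 / 2) β * btLog β)) / 1000) + (M * (Kc * powScale (1 / 6) β)) + (Real.sqrt 2 * ((min (1 / 40) (powScale (1 / 2) β * btLog β)) / 24) + ((D * recordDelta1 L (1 / 6) β))))) + 2 * ((min (1 / 40) (powScale (1 / 2) β * btLog β)) / 24)) * (((D * recordDelta1 L (1 / 6) β)) + ((12 * Kc + 1) / Fintype.card (Site 3 L) * powScale (1 / 6) β))))))) + 2 * ((min (1 / 40) (powScale (1 / 2) β * btLog β)) / 24)) * (((D * recordDelta1 L (1 / 6) β)) + ((12 * Kc + 1) / Fintype.card (Site 3 L) * powScale (1 / 6) β))))) ^ 2 ≤ ((min (1 / 40) (powScale (1 / 2) β * btLog β)) / 12) ^ 2 := by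
  have hs : (0 : ℝ) < 1 / 6 := by norm_num
  have hN1 : (1 : ℝ) ≤ Fintype.card (Site 3 L) := by exact_mod_cast Fintype.card_pos
  have hN : (0 : ℝ) < Fintype.card (Site 3 L) := by linarith
  -- the atoms
  have hr := tendsto_rf
  have hε₁ : Tendsto (fun β : ℝ => Kc * powScale (1 / 6) β) atTop (𝓝 0) := by simpa using (tendsto_powScale hs).const_mul Kc
  have hε₂ : Tendsto (fun β : ℝ => Kc ^ 3 * (btLog β)⁻¹) atTop (𝓝 0) := by
    simpa using (tendsto_inv_atTop_zero.comp tendsto_btLog_atTop).const_mul (Kc ^ 3)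
  have hatoms : Tendsto (fun β : ℝ => (powScale (1 / 2) β * btLog β, Kc * powScale (1 / 6) β, Kc ^ 3 * (btLog β)⁻¹)) atTop (𝓝 ((0 : ℝ), (0 : ℝ), (0 : ℝ))) :=
    hr.prodMk_nhds (hε₁.prodMk_nhds hε₂)
  -- the three polynomial conditions by continuity
  have hPθ : ∀ᶠ β : ℝ in atTop, (3 * L * (2 + 43 * M)) * (Kc * powScale (1 / 6) β) ≤ 1 / 40 := by
    have h := hε₁.const_mul (3 * L * (2 + 43 * M))
    rw [mul_zero] at h
    exact h.eventually (eventually_le_nhds (by norm_num))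
  have hPq : ∀ᶠ β : ℝ in atTop, 2 * C * ((powScale (1 / 2) β * btLog β) / 100 + Real.sqrt (6 * Fintype.card (Edge 3 L)) * (160 * (3 * L * (2 + 43 * M)) ^ 2 + 10 / 3 * (3 * L * (2 + 43 * M)) + 12 * (3 * L * (2 + 43 * M)) + 152 * (6 * (3 * L * (2 + 43 * M)) + 1 / 12)) * (Kc * powScale (1 / 6) β) ^ 2) ≤ 1 / 80 := by
    set P : ℝ × ℝ × ℝ → ℝ := fun p => 2 * C * (p.1 / 100 + Real.sqrt (6 * Fintype.card (Edge 3 L)) * (160 * (3 * L * (2 + 43 * M)) ^ 2 + 10 / 3 * (3 * L * (2 + 43 * M)) + 12 * (3 * L * (2 + 43 * M)) + 152 * (6 * (3 * L * (2 + 43 * M)) + 1 / 12)) * p.2.1 ^ 2) with hP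
    have hc : Continuous P := by rw [hP]; fun_prop
    have h := (hc.tendsto ((0 : ℝ), (0 : ℝ), (0 : ℝ))).comp hatoms
    have h0 : P ((0 : ℝ), (0 : ℝ), (0 : ℝ)) = 0 := by rw [hP]; norm_num
    rw [h0] at h
    filter_upwards [h.eventually (eventually_le_nhds (by norm_num : (0:ℝ) < 1 / 80))] with β hβ
    simpa only [hP, Function.comp] using hβ
  have hPfin : ∀ᶠ β : ℝ in atTop, Real.sqrt (6 * Fintype.card (Edge 3 L)) * (640 * (8 * C ^ 2 * (powScale (1 / 2) β * btLog β) / 10 ^ 4 + 8 * C ^ 2 * Real.sqrt (6 * Fintype.card (Edge 3 L)) ^ 2 * (160 * (3 * L * (2 + 43 * M)) ^ 2 + 10 / 3 * (3 * L * (2 + 43 * M)) + 12 * (3 * L * (2 + 43 * M)) + 152 * (6 * (3 * L * (2 + 43 * M)) + 1 / 12)) ^ 2 * ((Kc * powScale (1 / 6) β) * (Kc ^ 3 * (btLog β)⁻¹))) + 20 / 3 * (2 * C * (powScale (1 / 2) β * btLog β) / 100 + 2 * C * Real.sqrt (6 * Fintype.card (Edge 3 L)) * (160 * (3 * L * (2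 + 43 * M)) ^ 2 + 10 / 3 * (3 * L * (2 + 43 * M)) + 12 * (3 * L * (2 + 43 * M)) + 152 * (6 * (3 * L * (2 + 43 * M)) + 1 / 12)) * (Kc * powScale (1 / 6) β) ^ 2) + 1836 * (2 * C * (Kc * powScale (1 / 6) β) / 100 + 2 * C * Real.sqrt (6 * Fintype.card (Edge 3 L)) * (160 * (3 * L * (2 + 43 * M)) ^ 2 + 10 / 3 * (3 * L * (2 + 43 * M)) + 12 * (3 * L * (2 + 43 * M)) + 152 * (6 * (3 * L * (2 + 43 * M)) + 1 / 12)) * (Kc ^ 3 * (btLog β)⁻¹)) + 38 / 3 * (Kc * powScale (1 / 6) β)) ≤ 1 / 10000 := by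
    set P : ℝ × ℝ × ℝ → ℝ := fun p => Real.sqrt (6 * Fintype.card (Edge 3 L)) * (640 * (8 * C ^ 2 * p.1 / 10 ^ 4 + 8 * C ^ 2 * Real.sqrt (6 * Fintype.card (Edge 3 L)) ^ 2 * (160 * (3 * L * (2 + 43 * M)) ^ 2 + 10 / 3 * (3 * L * (2 + 43 * M)) + 12 * (3 * L * (2 + 43 * M)) + 152 * (6 * (3 * L * (2 + 43 * M)) + 1 / 12)) ^ 2 * (p.2.1 * p.2.2)) + 20 / 3 * (2 * C * p.1 / 100 + 2 * C * Real.sqrt (6 * Fintype.card (Edge 3 L)) * (160 * (3 * L * (2 + 43 * M)) ^ 2 + 10 / 3 * (3 * L * (2 + 43 * M)) + 12 * (3 * L * (2 + 43 * M)) + 152 * (6 * (3 * L * (2 + 43 * M)) + 1 / 12)) * p.2.1 ^ 2) + 1836 * (2 * C * p.2.1 / 100 + 2 * C * Real.sqrt (6 * Fintype.card (Edge 3 L)) * (160 * (3 * L * (2 + 43 * M)) ^ 2 + 10 / 3 * (3 * L * (2 + 43 * M)) + 12 * (3 * L * (2 + 43 * M)) + 152 * (6 * (3 * L * (2 + 43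 * M)) + 1 / 12)) * p.2.2) + 38 / 3 * p.2.1) with hP
    have hc : Continuous P := by rw [hP]; fun_prop
    have h := (hc.tendsto ((0 : ℝ), (0 : ℝ), (0 : ℝ))).comp hatoms
    have h0 : P ((0 : ℝ), (0 : ℝ), (0 : ℝ)) = 0 := by rw [hP]; norm_num
    rw [h0] at h
    filter_upwards [h.eventually (eventually_le_nhds (by norm_num : (0:ℝ) < 1 / 10000))] with β hβ
    simpa only [hP, Function.comp] using hβ
  -- elementary schedule facts
  have e1 : ∀ᶠ β : ℝ in atTop, min (1 / 40) (powScale (1 / 2) β * btLog β) = powScale (1 / 2) β * btLog β := by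
    filter_upwards [eventually_mul_le_of_tendsto hr 1 (by norm_num : (0:ℝ) < 1 / 40)] with β h
    rw [one_mul] at h; exact min_eq_right h
  have e2 : ∀ᶠ β : ℝ in atTop, powScale (1 / 2) β ≤ 1 / 10000 := (tendsto_powScale (σ := 1 / 2) (by norm_num)).eventually (eventually_le_nhds (by norm_num))
  have e3 : ∀ᶠ β : ℝ in atTop, powScale (1 / 2 - 1 / 6) β * btLog β ≤ Kc := by
    have h := tendsto_powScale_mul_btLog_pow (p := 1 / 2 - 1 / 6) (by norm_num) 1
    simp only [pow_one] at h
    exact h.eventually (eventually_le_nhds (by linarith))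
  have e4 : ∀ᶠ β : ℝ in atTop, (D * recordDelta1 L (1 / 6) β) ≤ 1 ∧ 12 * Real.sqrt (3 * Fintype.card (Edge 3 L)) * (D * recordDelta1 L (1 / 6) β) * C ≤ 1 / 2 := by
    have hδt : Tendsto (fun β : ℝ => (D * recordDelta1 L (1 / 6) β)) atTop (𝓝 0) := by
      have h := (tendsto_powScale hs).const_mul (D * 14 / (Fintype.card (Site 3 L) : ℝ))
      rw [mul_zero] at h
      refine h.congr fun β => ?_
      unfold recordDelta1; ring
    have h2 := (hδt.const_mul (12 * Real.sqrt (3 * Fintype.card (Edge 3 L)))).mul_const C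
    rw [mul_zero, zero_mul] at h2
    filter_upwards [hδt.eventually (eventually_le_nhds one_pos), h2.eventually (eventually_le_nhds (by norm_num : (0:ℝ) < 1 / 2))] with β h1 h3
    exact ⟨h1, by simpa [mul_assoc] using h3⟩
  filter_upwards [hPθ, hPq, hPfin, e1, e2, e3, e4, eventually_ge_atTop (1 : ℝ)] with β hθ hq hfin hrf hx4 hxs ⟨hδ1, hδC⟩ hβ1
  -- positivity of the data
  have hx0 : 0 < powScale (1 / 2) β := powScale_pos _ _
  have hℓ1 : 1 ≤ btLog β := one_le_btLog β
  have hℓ0 : 0 ≤ btLog β := zero_le_one.trans hℓ1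
  have hps0 : 0 < powScale (1 / 6) β := powScale_pos _ _
  have hrF0 : 0 ≤ (min (1 / 40) (powScale (1 / 2) β * btLog β)) := le_min (by norm_num) (mul_nonneg hx0.le hℓ0)
  have hrF40 : (min (1 / 40) (powScale (1 / 2) β * btLog β)) ≤ 1 / 40 := min_le_left _ _
  have hτ0 : 0 ≤ (powScale 1 β * btLog β) := mul_nonneg (powScale_pos _ _).le hℓ0
  have hδ0 : 0 ≤ ((D * recordDelta1 L (1 / 6) β)) := by unfold recordDelta1; positivity
  have hδ'0 : 0 ≤ ((12 * Kc + 1) / Fintype.card (Site 3 L) * powScale (1 / 6) β) := by positivity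
  have haU0 : 0 ≤ (M * (Kc * powScale (1 / 6) β)) := by positivity
  have hε₁0 : 0 ≤ Kc * powScale (1 / 6) β := by positivity
  -- the atom inequalities
  have hrF : (min (1 / 40) (powScale (1 / 2) β * btLog β)) ≤ Kc * powScale (1 / 6) β := by
    rw [hrf]
    have e : powScale (1 / 2) β * btLog β = (powScale (1 / 2 - 1 / 6) β * btLog β) * powScale (1 / 6) β := by
      rw [mul_assoc, mul_comm (btLog β), ← mul_assoc, powScale_mul_powScale]; ring_nf
    rw [e]; exact mul_le_mul_of_nonneg_right hxs hps0.le
  have hδ : ((D * recordDelta1 L (1 / 6) β)) ≤ Kc * powScale (1 / 6) β := by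
    unfold recordDelta1
    have e : D * (14 * powScale (1 / 6) β / Fintype.card (Site 3 L)) = (14 * D / Fintype.card (Site 3 L)) * powScale (1 / 6) β := by ring
    rw [e]; exact mul_le_mul_of_nonneg_right hDK hps0.le
  have hδ' : ((12 * Kc + 1) / Fintype.card (Site 3 L) * powScale (1 / 6) β) ≤ 37 * (Kc * powScale (1 / 6) β) := by
    have h1 : (12 * Kc + 1) / Fintype.card (Site 3 L) ≤ 12 * Kc + 1 := div_le_self (by positivity) hN1
    have h2 : 12 * Kc + 1 ≤ 37 * Kc := by linarith
    have := mul_le_mul_of_nonneg_right (h1.trans h2) hps0.le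
    linarith
  have haU : (M * (Kc * powScale (1 / 6) β)) ≤ 43 * M * (Kc * powScale (1 / 6) β) := by
    have : 0 ≤ M * (Kc * powScale (1 / 6) β) := by positivity
    linarith
  have hτ : (powScale 1 β * btLog β) ≤ (min (1 / 40) (powScale (1 / 2) β * btLog β)) / 10000 := by
    rw [hrf]
    have e : powScale 1 β = powScale (1 / 2) β * powScale (1 / 2) β := by rw [powScale_mul_powScale]; norm_num
    rw [e]
    have := mul_le_mul_of_nonneg_right hx4 (mul_nonneg hx0.le hℓ0)
    nlinarith [this]
  have hε13 : (Kc * powScale (1 / 6) β) ^ 3 ≤ (Kc ^ 3 * (btLog β)⁻¹) * (min (1 / 40) (powScale (1 / 2) β * btLog β)) := by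
    rw [hrf]
    have hℓne : btLog β ≠ 0 := by linarith
    have e : (Kc * powScale (1 / 6) β) ^ 3 = Kc ^ 3 * powScale (1 / 2) β := by
      rw [mul_pow]
      have : powScale (1 / 6) β ^ 3 = powScale (1 / 2) β := by
        rw [pow_succ, pow_two, powScale_mul_powScale, powScale_mul_powScale]; norm_num
      rw [this]
    rw [e]
    have e2 : Kc ^ 3 * (btLog β)⁻¹ * (powScale (1 / 2) β * btLog β) = Kc ^ 3 * powScale (1 / 2) β := by field_simp
    rw [e2]
  -- the polynomial conditions at `rF = ps(1/2)ℓ`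
  have hq' : 2 * C * ((min (1 / 40) (powScale (1 / 2) β * btLog β)) / 100 + Real.sqrt (6 * Fintype.card (Edge 3 L)) * (160 * (3 * L * (2 + 43 * M)) ^ 2 + 10 / 3 * (3 * L * (2 + 43 * M)) + 12 * (3 * L * (2 + 43 * M)) + 152 * (6 * (3 * L * (2 + 43 * M)) + 1 / 12)) * (Kc * powScale (1 / 6) β) ^ 2) ≤ 1 / 80 := by rw [hrf]; exact hq
  have hfin' : Real.sqrt (6 * Fintype.card (Edge 3 L)) * (640 * (8 * C ^ 2 * (min (1 / 40) (powScale (1 / 2) β * btLog β)) / 10 ^ 4 + 8 * C ^ 2 * Real.sqrt (6 * Fintype.card (Edge 3 L)) ^ 2 * (160 * (3 * L * (2 + 43 * M)) ^ 2 + 10 / 3 * (3 * L * (2 + 43 * M)) + 12 * (3 * L * (2 + 43 * M)) + 152 * (6 * (3 * L * (2 + 43 * M)) + 1 / 12)) ^ 2 * ((Kc * powScale (1 / 6) β) * (Kc ^ 3 * (btLog β)⁻¹))) + 20 / 3 * (2 * C * (min (1 / 40) (powScale (1 / 2) β * btLog β)) / 100 + 2 * C * Real.sqrt (6 * Fintype.card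 (Edge 3 L)) * (160 * (3 * L * (2 + 43 * M)) ^ 2 + 10 / 3 * (3 * L * (2 + 43 * M)) + 12 * (3 * L * (2 + 43 * M)) + 152 * (6 * (3 * L * (2 + 43 * M)) + 1 / 12)) * (Kc * powScale (1 / 6) β) ^ 2) + 1836 * (2 * C * (Kc * powScale (1 / 6) β) / 100 + 2 * C * Real.sqrt (6 * Fintype.card (Edge 3 L)) * (160 * (3 * L * (2 + 43 * M)) ^ 2 + 10 / 3 * (3 * L * (2 + 43 * M)) + 12 * (3 * L * (2 + 43 * M)) + 152 * (6 * (3 * L * (2 + 43 * M)) + 1 / 12)) * (Kc ^ 3 * (btLog β)⁻¹)) + 38 / 3 * (Kc * powScale (1 / 6) β)) ≤ 1 / 10000 := by rw [hrf]; exact hfin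
  obtain ⟨h1, h2, h3⟩ := stiffSep_conditions (L := L) hC hM hrF0 hτ0 hδ0 hδ'0 haU0 hε₁0 hrF hδ hδ' haU hτ hε13 hθ hq' hfin'
  exact ⟨hrF0, by linarith, hτ0, hδ0, hδ1, hδ'0, haU0, hδC, h1, h2, h3⟩

end Summit.QuantumFields.YangMills.Theorems.FemtoTransferGap.TwoLattice.ConstTube

end
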